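import Literature.Topology.FourManifolds.MMSWTwistedPictureTransverse
import Literature.Topology.FourManifolds.MMSWBandGenericity
import Literature.Topology.FourManifolds.MMSWEventualRasmussenReduction
import HarnessLib

/-!
# Generic strip twists of a model knot have Gauss diagrams, eventually

Glue file of the read-off line towards the named fact
`Literature.Topology.FourManifolds.MMSW.eventually_approxHasRasmussen` (Manolescu–Marengon–
Sarkar–Willis, arXiv:1910.08195, Thm. 1.4 / Prop. 8.2 (i); §8.1 in the tree's picture):
`MMSWBandGenericity.exists_generic_bands` (generic offset bands exist for a picture in general
position) + `MMSWTwistedPictureTransverse.eventually_inGeneralPosition_twisted` (with generic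
bands the twisted pictures are in general position for all large `k`) +
`GaussDiagramsReadOff.InGeneralPosition.hasGaussDiagram` (a knot in general position has a Gauss
diagram) + `MMSWPictureGeneralPosition.IsModelKnot.exists_isSmoothModelIsotopy_inGeneralPosition`
(every core-missing model knot is model-isotopic to one whose picture is in general position):

* `exists_generic_bands_eventually_inGeneralPosition` — for a core-missing model knot whose
  picture `D(0⃗)(K)` is a tree knot in general position there are admissible bands `(w, e)` and
  `k₁` such that `D(0⃗)(stripTwistAt_k ∘ K)` is in general position for every `k ≥ k₁`;
* `exists_generic_bands_eventually_hasGaussDiagram` — hence each of them has a Gauss diagram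
  (the canonical one read off its crossing set).

What remains for the named fact is purely about these diagrams: their explicit description
(`k` rounds of upper-over-lower chords per band inserted into the diagram of `D(0⃗)(K)`) and the
stabilisation of their Rasmussen invariants (MMSW Thm. 3.3).  Everything here is proved; no
definitions, no named facts.

## References

* C. Manolescu, M. Marengon, S. Sarkar, M. Willis, Duke Math. J. 172 (2023), arXiv:1910.08195,
  §2.1, §8.1, Thm. 3.3. [ManolescuMarengonSarkarWillis2023]
* P. R. Cromwell, *Knots and Links*, CUP (2004), §3.2–3.3. [Cromwell2004]
-/

open scoped Manifold ContDiff Topology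
open Function Set Filter Complex

noncomputable section

namespace Literature.Topology.FourManifolds

/-- Local notation: `𝔼 n` is the model Euclidean space `EuclideanSpace ℝ (Fin n)`. -/
local notation "𝔼 " n:arg => EuclideanSpace ℝ (Fin n)

/-- Local notation: `𝕊 n` is the unit sphere in `EuclideanSpace ℝ (Fin (n + 1))`. -/
local notation "𝕊 " n:arg => (Metric.sphere (0 : EuclideanSpace ℝ (Fin (n + 1))) 1)

namespace MMSW

open Literature.AlgebraicTopology.Homotopy.HopfFibration (zC wC)

variable {r : ℕ}

/-- **Generic bands make the twisted pictures eventually generic.**  For a core-missing model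
knot `K` whose picture `D(0⃗)(K)` is a tree knot in general position there are admissible offset
bands and `k₁` with `D(0⃗)(stripTwistAt_k ∘ K)` in general position for every `k ≥ k₁`.
[cite: ManolescuMarengonSarkarWillis2023, §8.1] -/
theorem exists_generic_bands_eventually_inGeneralPosition {K : 𝕊 1 → 𝔼 4} (hK : IsModelKnot r K)
    (hwK : ∀ t, wC (K t) ≠ 0) {K₃ : Knot} (hK₃ : ⇑K₃ = finiteApprox r 0 K)
    (hgp : K₃.InGeneralPosition) :
    ∃ (w : ℝ) (e : Fin r → ℝ) (k₁ : ℕ), 0 < w ∧ (∀ j, |e j| + w < 1) ∧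
      ∀ k : ℕ, k₁ ≤ k → ∀ K₃k : Knot,
        ⇑K₃k = finiteApprox r 0 (stripTwistAt r (k : ℤ) w e ∘ K) → K₃k.InGeneralPosition := by
  obtain ⟨w, e, hw, he, hcross, hcrit⟩ := exists_generic_bands hK hgp
  obtain ⟨k₁, hk₁⟩ := eventually_inGeneralPosition_twisted hK hwK hK₃ hgp hw he hcross hcrit
  exact ⟨w, e, k₁, hw, he, hk₁⟩

/-- **Hence the twisted pictures eventually have Gauss diagrams** (the canonical ones read off
their crossing sets). [cite: ManolescuMarengonSarkarWillis2023, §8.1] -/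
theorem exists_generic_bands_eventually_hasGaussDiagram {K : 𝕊 1 → 𝔼 4} (hK : IsModelKnot r K)
    (hwK : ∀ t, wC (K t) ≠ 0) {K₃ : Knot} (hK₃ : ⇑K₃ = finiteApprox r 0 K)
    (hgp : K₃.InGeneralPosition) :
    ∃ (w : ℝ) (e : Fin r → ℝ) (k₁ : ℕ), 0 < w ∧ (∀ j, |e j| + w < 1) ∧
      ∀ k : ℕ, k₁ ≤ k → ∀ K₃k : Knot,
        ⇑K₃k = finiteApprox r 0 (stripTwistAt r (k : ℤ) w e ∘ K) →
          ∃ G : GaussDiagram, K₃k.HasGaussDiagram G := by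
  obtain ⟨w, e, k₁, hw, he, hk₁⟩ := exists_generic_bands_eventually_inGeneralPosition hK hwK hK₃ hgp
  exact ⟨w, e, k₁, hw, he, fun k hk K₃k hK₃k ↦ ⟨_, (hk₁ k hk K₃k hK₃k).hasGaussDiagram⟩⟩

/-- **Every core-missing model knot admits, up to a core-missing model isotopy preserving all
`ApproxHasRasmussen r k`, generic bands whose twisted pictures are eventually in general
position.** [cite: ManolescuMarengonSarkarWillis2023, §8.1] -/
theorem IsModelKnot.exists_isotopy_generic_bands {K : 𝕊 1 → 𝔼 4} (hK : IsModelKnot r K)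
    (hwK : ∀ t, wC (K t) ≠ 0) :
    ∃ K' : 𝕊 1 → 𝔼 4, IsSmoothModelIsotopy r K K' ∧ IsModelKnot r K' ∧ (∀ t, wC (K' t) ≠ 0) ∧
      (∀ k s, ApproxHasRasmussen r k K s ↔ ApproxHasRasmussen r k K' s) ∧
      ∃ (K₃' : Knot) (w : ℝ) (e : Fin r → ℝ) (k₁ : ℕ), ⇑K₃' = finiteApprox r 0 K' ∧
        K₃'.InGeneralPosition ∧ 0 < w ∧ (∀ j, |e j| + w < 1) ∧
        ∀ k : ℕ, k₁ ≤ k → ∀ K₃k : Knot,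
          ⇑K₃k = finiteApprox r 0 (stripTwistAt r (k : ℤ) w e ∘ K') → K₃k.InGeneralPosition := by
  obtain ⟨K', hiso, hK', hw', hiff, K₃', hK₃', hgp⟩ := hK.exists_isSmoothModelIsotopy_inGeneralPosition hwK
  obtain ⟨w, e, k₁, hw, he, hk₁⟩ := exists_generic_bands_eventually_inGeneralPosition hK' hw' hK₃' hgp
  exact ⟨K', hiso, hK', hw', hiff, K₃', w, e, k₁, hK₃', hgp, hw, he, hk₁⟩

/-! ## The named fact, reduced to the stability of the twisted DIAGRAMS -/

/-- A Gauss diagram of a picture knot with Rasmussen invariant `s` witnesses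
`ApproxHasRasmussen r 0`. [folklore] -/
theorem approxHasRasmussen_zero_of_hasGaussDiagram {K : 𝕊 1 → 𝔼 4} {K₃ : Knot}
    (hK₃ : ⇑K₃ = finiteApprox r 0 K) {G : GaussDiagram} (hG : K₃.HasGaussDiagram G) {s : ℤ}
    (hs : G.rasmussenInvariant = s) : ApproxHasRasmussen r 0 K s :=
  ⟨K₃, hK₃, K₃, G, SphereEmbedding.IsIsotopic.refl K₃, hG, hs⟩

/-- **Reduction of the named fact to DIAGRAM STABILITY.**  `eventually_approxHasRasmussen`
follows from: for every `r ≥ 1` and every core-missing null-homologous model knot `K ⊂ M_r`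
whose picture `D(0⃗)(K)` is a tree knot in general position, and every choice of generic offset
bands for it (in the sense of `exists_generic_bands`: crossing values and critical values of
`Re z` off the closed windows), the twisted pictures `D(0⃗)(stripTwistAt_k ∘ K)` eventually admit
Gauss diagrams with one and the same Rasmussen invariant.  (They do admit Gauss diagrams
eventually, `exists_generic_bands_eventually_hasGaussDiagram`; what is asked is the constancy of
`s` — MMSW's Thm. 3.3 read on these explicit diagrams.)
[cite: ManolescuMarengonSarkarWillis2023, Thm. 3.3, Prop. 8.2 (i) and §8.1] -/
theorem eventually_approxHasRasmussen_of_twistedDiagramStable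
    (h : ∀ {r : ℕ} {K : 𝕊 1 → 𝔼 4}, 0 < r → IsModelKnot r K → IsNullHomologous r K →
      (∀ t, wC (K t) ≠ 0) → ∀ {K₃ : Knot}, ⇑K₃ = finiteApprox r 0 K → K₃.InGeneralPosition →
      ∀ {w : ℝ} {e : Fin r → ℝ}, 0 < w → (∀ j, |e j| + w < 1) →
      (∀ j : Fin r, ∀ s ∈ Knot.crossingSet K₃, (zC (K (circlePoint s))).re ∉
        Icc ((holeCentre r j).re + e j - w) ((holeCentre r j).re + e j + w)) →
      (∀ (j : Fin r) (θ : ℝ), deriv (fun θ : ℝ ↦ (zC (K (circlePoint θ))).re) θ = 0 →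
        (zC (K (circlePoint θ))).re ∉
          Icc ((holeCentre r j).re + e j - w) ((holeCentre r j).re + e j + w)) →
      ∃ (s : ℤ) (k₀ : ℕ), ∀ k : ℕ, k₀ ≤ k → ∀ K₃k : Knot,
        ⇑K₃k = finiteApprox r 0 (stripTwistAt r (k : ℤ) w e ∘ K) →
          ∃ G : GaussDiagram, K₃k.HasGaussDiagram G ∧ G.rasmussenInvariant = s) :
    eventually_approxHasRasmussen := by
  refine eventually_approxHasRasmussen_of_stripStableAt_inGeneralPosition
    fun {r} {K} hr hK h0 hwK ⟨K₃, hK₃, hgp⟩ ↦ ?_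
  obtain ⟨w, e, hw, he, hcross, hcrit⟩ := exists_generic_bands hK hgp
  obtain ⟨s, k₀, hk₀⟩ := h hr hK h0 hwK hK₃ hgp hw he hcross hcrit
  refine ⟨w, e, s, (k₀ : ℤ), hw, he, fun k hk ↦ ?_⟩
  -- `k ≥ k₀ ≥ 0` is a natural number
  obtain ⟨n, rfl⟩ : ∃ n : ℕ, k = (n : ℤ) := ⟨k.toNat, (Int.toNat_of_nonneg (le_trans (by positivity) hk)).symm⟩
  have hn : k₀ ≤ n := by exact_mod_cast hk
  have hKk : IsModelKnot r (stripTwistAt r (n : ℤ) w e ∘ K) := hK.stripTwistAt_comp (n : ℤ) hw he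
  have hwk : ∀ t, wC ((stripTwistAt r (n : ℤ) w e ∘ K) t) ≠ 0 := fun t ↦
    wC_stripTwistAt_ne_zero (n : ℤ) w e (hwK t)
  obtain ⟨K₃k, hK₃k⟩ := hKk.exists_knot_coe_eq_finiteApprox hwk 0
  obtain ⟨G, hG, hs⟩ := hk₀ n hn K₃k hK₃k
  exact approxHasRasmussen_zero_of_hasGaussDiagram hK₃k hG hs

end MMSW

end Literature.Topology.FourManifolds

end
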